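import Literature.NumberTheory.EllipticCurves.CasselsTateSelmerLocalValue
import Literature.NumberTheory.EllipticCurves.HeegnerPointsKolyvaginLocalCriterion
import HarnessLib

/-!
# The pulled-back Cassels–Tate value on a Kolyvagin pair: reduction to the term at `λ`

Topic `NumberTheory/EllipticCurves`; namespace `Literature.NumberTheory.EllipticCurves`. Theorems only:
**no definition and no named fact is introduced** (D-0026). Sequel of `CasselsTateSelmerLocalValue`.

McCallum 1991, Prop. 4.7 (PDF p. 284), in the situation of the proof of his Thm. 5.4 (p. 288): the
level is `m` with auxiliary level `m²` (Kolyvagin: `m = p^{M₀}`, `m² = p^M`, `M = 2M₀`), the first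
class is `z = m • (k • c)` with `c = c_M(n) ∈ H¹(K, E[m²])`, `n = ℓ m'` (Kolyvagin: `k = p^{j-M₀}`,
`z = p^j c_M(n)`), the second is a Selmer class `t` killed by `m` (Kolyvagin: `p^N t = 0`, `N ≤ M₀`)
which vanishes in `H¹(K_v, E[m²])` at the places `v ∈ T` over the primes of `m'`. The hypotheses are
stated in the vocabulary of the descent (`HeegnerPointsKolyvaginPrimaryLeavesProofs`): `c` lies in
the Selmer local kernel `selmerLocalKer` at every place other than `λ = v₀` and the places of `T`
(McCallum Lemma 4.3, and the complex places), `loc_v t = 0` for `v ∈ T`, the absolute Galois groups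
of the completions at `v ∈ T` fix `E[m²]` (Kolyvagin primes of level `m²`,
`HeegnerPointsKolyvaginPrimaryLocalTrivialProofs`), and `E[m]` has no non-zero `Γ_K`-fixed point
(`E(K)[p] = 0`).

* `mem_kummerLocalConditionAt_res_of_mem_selmerLocalKer` — the bridge
  `c ∈ selmerLocalKer W (K_v) n → loc_v c ∈ 𝓛_v^{(n)}` (tree `comap_res_kummerLocalConditionAt`);
* `exists_firstCaseData_kolyvagin` — first-case data `D` with `D.b₁ = k • c`, `ι_* D.b' = t` exist;
* `ctLevelPairing_pullback_eq_localTerm_kolyvagin` — for every such `D`, the pulled-back pairing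
  `B(ι z, ι t)` (`B = ctLevelPairing` at level `m`) is `zmodToCircle (m²)` of the local term of `D` at
  `λ`; `ctLevelPairing_pullback_ne_zero_iff_localTerm_kolyvagin` — hence non-zero iff that term is.

What remains of McCallum's value formula after this file is the LOCAL statement at `λ` (his Lemma 5.3:
*"the groups `E(K_λ)/p^M` and `H¹(K_λ, E)_{p^M}` … pair nontrivially if their orders multiply to
more than `p^M`"*): `inv_λ((loc_λ (k • c) - β_λ) ∪ β'_λ) ≠ 0` under the order conditions of the proof
of Thm. 5.4. All Cassels–Tate hypotheses are the tree's (`halt`, `hPT'`, `hH3`, `hfin`).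

## References

* [McCallumLMS1991] W. G. McCallum, *Kolyvagin's work on Shafarevich–Tate groups* (1991), §4
  Lemma 4.3, Prop. 4.7; §5 Lemma 5.3, Thm. 5.4 (proof).
* [MilneADT2006] J. S. Milne, *Arithmetic Duality Theorems*, 2nd ed. (2006), Ch. I §6, proof of
  Prop. 6.9.
-/

noncomputable section

open scoped Classical
open scoped AddSubgroup

universe u

namespace Literature.NumberTheory.EllipticCurves

open CategoryTheory _root_.WeierstrassCurve Field Function NumberField IsDedekindDomain
open Literature.NumberTheory.GaloisRepresentations Literature.NumberTheory.GaloisCohomology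
open Literature.NumberTheory.GaloisRepresentations.DiscreteGaloisModule (mu MuCarrier pairing)
open Literature.GroupTheory.FiniteAbelian
open scoped ContRepresentation

-- Cup products need `LocallyCompactSpace Γ`; as in the tree's cup-product files, the compactness of
-- absolute Galois groups is a local instance only.
attribute [local instance] absoluteGaloisGroup_compactSpace

-- `char K_v = 0` for the completions of a number field (local instance, no override).
attribute [local instance] charZero_placeCompletion

section Bridge

variable {K : Type u} [Field K] (W : WeierstrassCurve K) (n : ℤ) (E : Type u) [Field E] [Algebra K E]

/-- **Bridge between the descent's local condition and the Selmer structure's**: a class in the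
Selmer local kernel `ker (H¹(K, E[n]) → H¹(K_v, E))` (`selmerLocalKer`, the `Loc v` of
`HeegnerPointsKolyvaginPrimaryLeavesProofs`) restricts into the local Kummer condition `𝓛_v^{(n)}`
(`kummerLocalConditionAt`; tree `comap_res_kummerLocalConditionAt`). [cite: MilneADT2006, Ch. I §6, (6.14)] -/
theorem mem_kummerLocalConditionAt_res_of_mem_selmerLocalKer {c : galH1Torsion W n}
    (hc : c ∈ selmerLocalKer W E n) :
    galoisCohomology.res (W.torsionGaloisModule n) E 1 c ∈ W.kummerLocalConditionAt n E := by
  have h := (SetLike.ext_iff.mp (W.comap_res_kummerLocalConditionAt n E) c).mpr hc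
  exact AddSubgroup.mem_comap.mp h

/-- Converse of `mem_kummerLocalConditionAt_res_of_mem_selmerLocalKer`. [cite: MilneADT2006, Ch. I §6, (6.14)] -/
theorem mem_selmerLocalKer_of_mem_kummerLocalConditionAt_res {c : galH1Torsion W n}
    (hc : galoisCohomology.res (W.torsionGaloisModule n) E 1 c ∈ W.kummerLocalConditionAt n E) :
    c ∈ selmerLocalKer W E n :=
  (SetLike.ext_iff.mp (W.comap_res_kummerLocalConditionAt n E) c).mp (AddSubgroup.mem_comap.mpr hc)

/-- **Bridge between the descent's strict local condition and restriction**: for `E = W` elliptic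
over a number field and a `K`-field `F` of characteristic `0` (a completion), a class lies in
`torsionLocalKer W F n = ker (H¹(K, E[n]) → H¹(F, E(K̄_F)[n]))` (McCallum's "`c_λ = 0`", the `A ℓ` of
`HeegnerPointsKolyvaginPrimaryLeavesProofs`) iff its restriction `res_F` to `H¹(Γ_F, E[n](K̄))`
vanishes — `E(K̄)[n] → E(K̄_F)[n]` being an isomorphism of `Γ_F`-modules (`torsionPointsMap_bijective`).
[cite: McCallumLMS1991, §3 (3)] [cite: SilvermanAEC2009, Cor. III.6.4(b)] -/
theorem mem_torsionLocalKer_iff_res_eq_zero [NumberField K] [W.IsElliptic] [CharZero E] {k : ℕ}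
    (hk : k ≠ 0) (x : galH1Torsion W (k : ℤ)) :
    x ∈ W.torsionLocalKer E (k : ℤ) ↔ galoisCohomology.res (W.torsionGaloisModule (k : ℤ)) E 1 x = 0 := by
  set φ := reprCocycle W (k : ℤ) x with hφ
  have hclass : oneCocycleClass _ φ = x := oneCocycleClass_reprCocycle W (k : ℤ) x
  have hinj := torsionPointsMap_injective W E (k : ℤ)
  have hsurj := (torsionPointsMap_bijective W E hk).2
  have hker : x ∈ W.torsionLocalKer E (k : ℤ) ↔
      ∃ Q : AddSubgroup.torsionBy (localPoints W E) (k : ℤ), ∀ g : absoluteGaloisGroup E,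
        torsionPointsMap W E (k : ℤ) (φ.1 (resGal (K := K) E g)) = g • Q - Q := by
    rw [← hclass]
    exact oneCocycleClass_mem_resKer_iff _ _ _ φ
  rw [hker, ← hclass, WeierstrassCurve.res_torsionGaloisModule_oneCocycleClass]
  refine Iff.trans ?_ (oneCocycleClass_eq_zero_iff _ _).symm
  constructor
  · rintro ⟨Q, hQ⟩
    obtain ⟨P, rfl⟩ := hsurj Q
    refine ⟨P, fun g => hinj ?_⟩
    change torsionPointsMap W E (k : ℤ) (φ.1 (resGal (K := K) E g)) =
      torsionPointsMap W E (k : ℤ) (resGal (K := K) E g • P - P)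
    rw [hQ g, map_sub, torsionPointsMap_smul]
  · rintro ⟨P, hP⟩
    refine ⟨torsionPointsMap W E (k : ℤ) P, fun g => ?_⟩
    have h := hP g
    change φ.1 (resGal (K := K) E g) = resGal (K := K) E g • P - P at h
    rw [h, map_sub, torsionPointsMap_smul]

end Bridge

section Kolyvagin

variable {K : Type u} [Field K] [NumberField K] {W : WeierstrassCurve K} {m : ℕ} [NeZero m]
variable (e : geomTorsion W ((m * m : ℕ) : ℤ) → geomTorsion W ((m * m : ℕ) : ℤ) → AlgebraicClosure K)
  (hμ : ∀ S T, e S T ^ (m * m) = 1)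
  (hadd₁ : ∀ S₁ S₂ T, e (S₁ + S₂) T = e S₁ T * e S₂ T)
  (hadd₂ : ∀ S T₁ T₂, e S (T₁ + T₂) = e S T₁ * e S T₂)
  (hgal : ∀ (σ : absoluteGaloisGroup K) (S T : geomTorsion W ((m * m : ℕ) : ℤ)),
    σ • e S T = e (σ • S) (σ • T))
variable (inv : LocalInvariants K (m * m))
-- `hPT'` is the reciprocity predicate `LocalInvariants.SumInvLocalizationEqZero` on `inv`, not a named fact.
variable (halt : ∀ T, e T T = 1) (hPT' : inv.SumInvLocalizationEqZero)
  (hH3 : ∀ c : galoisCohomology (mu K (m * m)) 3,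
    (∀ v : Place K, galoisCohomology.localization (mu K (m * m)) v 3 c = 0) → c = 0)
  (hfin : ∀ D : GeneralCaseData W m e hμ hadd₁ hadd₂ hgal, ∃ S : Finset (Place K), ∀ v ∉ S, D.localTerm inv v = 0)
variable (ι : selmerGroup W ((m * m : ℕ) : ℤ) →+ (W.sha)[m])
  (hι : ∀ z, shaTorsionVal W m (ι z) = torsionH1ToH1 W ((m * m : ℕ) : ℤ) z)

/-- **First-case data for a Kolyvagin pair**: for Selmer classes `z = m • (k • c)` and `t` with
`m • t = 0`, at level `m²`, and `E[m]` without non-zero `Γ_K`-fixed points (so `[m]_* t = 0`,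
`map_mulK_eq_zero_of_zsmul_eq_zero`), there are first-case data `D` at level `m` with
`D.b₁ = k • c` and `ι_* D.b' = t`. [cite: McCallumLMS1991, §5 Thm. 5.4 (proof)]
[cite: MilneADT2006, Ch. I §6, proof of Prop. 6.9] -/
theorem exists_firstCaseData_kolyvagin [W.IsElliptic] (z t : selmerGroup W ((m * m : ℕ) : ℤ))
    (c : galoisCohomology (W.torsionGaloisModule ((m * m : ℕ) : ℤ)) 1) (k : ℤ)
    (hz : (z : galH1Torsion W ((m * m : ℕ) : ℤ)) = (m : ℤ) • k • c)
    (hfix : ∀ P : geomTorsion W (m : ℤ), (∀ σ : absoluteGaloisGroup K, σ • P = P) → P = 0)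
    (hmt : (m : ℤ) • (t : galH1Torsion W ((m * m : ℕ) : ℤ)) = 0) :
    ∃ D : FirstCaseData W m, D.b₁ = k • c ∧
      galoisCohomology.map (inclKD W m m) 1 D.b' = (t : galH1Torsion W ((m * m : ℕ) : ℤ)) := by
  have hb₁ : (m : ℤ) • (k • c) ∈ selmerGroup W ((m * m : ℕ) : ℤ) := by
    have h := z.2
    rw [show (z : galH1Torsion W ((m * m : ℕ) : ℤ)) = (m : ℤ) • k • c from hz] at h
    exact h
  exact exists_firstCaseData_of_zsmul_of_map_mulK_eq_zero W m hb₁ t.2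
    (map_mulK_eq_zero_of_zsmul_eq_zero W m hfix hmt)

include halt hPT' hι in
/-- **McCallum's Prop. 4.7 for a Kolyvagin pair, pulled-back level-`m` Cassels–Tate pairing.** Let
`z = m • (k • c)` and `t` be Selmer classes at level `m²`, `λ = v₀` a finite place and `T` a
set of finite places such that: `c` lies in the Selmer local kernel at every place other than `λ`
and those of `T` (McCallum Lemma 4.3 for `c = c_M(ℓ m')`, `T` the places of `m'`; the complex places);
`loc_v t = 0` for `v ∈ T`; and `Γ_{K_v}` fixes `E[m²]` for `v ∈ T` (Kolyvagin primes of level `m²`).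
Then for every first-case data `D` with `D.b₁ = k • c` and `ι_* D.b' = t`,
`B(ι z, ι t) = zmodToCircle (m²) (inv_λ((loc_λ (k • c) - β_λ) ∪ β'_λ))`.
[cite: McCallumLMS1991, §4 Prop. 4.7, §5 Thm. 5.4 (proof)] [cite: MilneADT2006, Ch. I §6, proof of Prop. 6.9] -/
theorem ctLevelPairing_pullback_eq_localTerm_kolyvagin [W.IsElliptic]
    (z t : selmerGroup W ((m * m : ℕ) : ℤ))
    (c : galoisCohomology (W.torsionGaloisModule ((m * m : ℕ) : ℤ)) 1) (k : ℤ)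
    (hz : (z : galH1Torsion W ((m * m : ℕ) : ℤ)) = (m : ℤ) • k • c)
    (v₀ : HeightOneSpectrum (𝓞 K)) (T : Set (HeightOneSpectrum (𝓞 K)))
    (hc : ∀ v : Place K, v ≠ Sum.inr v₀ → (∀ q ∈ T, v ≠ Sum.inr q) →
      c ∈ selmerLocalKer W (Place.Completion v) ((m * m : ℕ) : ℤ))
    (htT : ∀ q ∈ T, galoisCohomology.res (W.torsionGaloisModule ((m * m : ℕ) : ℤ))
      (Place.Completion (Sum.inr q : Place K)) 1 (t : galH1Torsion W ((m * m : ℕ) : ℤ)) = 0)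
    (htrivT : ∀ q ∈ T, ∀ (g : absoluteGaloisGroup (Place.Completion (Sum.inr q : Place K)))
      (Q : geomTorsion W ((m * m : ℕ) : ℤ)), absGaloisRestrict K (Place.Completion (Sum.inr q : Place K)) g • Q = Q)
    (D : FirstCaseData W m) (hD₁ : D.b₁ = k • c)
    (hDt : galoisCohomology.map (inclKD W m m) 1 D.b' = (t : galH1Torsion W ((m * m : ℕ) : ℤ))) :
    ctLevelPairing W m e hμ hadd₁ hadd₂ hgal inv halt hPT' hH3 hfin (ι z) (ι t) =
      zmodToCircle (m * m) (D.localTerm e hμ hadd₁ hadd₂ hgal inv (Sum.inr v₀)) := by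
  have hz' : (z : galH1Torsion W ((m * m : ℕ) : ℤ)) = (m : ℤ) • (k • c) := hz
  refine ctLevelPairing_pullback_eq_localTerm e hμ hadd₁ hadd₂ hgal inv halt hPT' hH3 hfin ι hι z t hz'
    D hD₁ hDt (Sum.inr v₀) fun v hv => ?_
  by_cases hvT : ∃ q ∈ T, v = Sum.inr q
  · obtain ⟨q, hq, rfl⟩ := hvT
    exact Or.inr ⟨htT q hq,
      map_inclKD_restrictField_injective_of_forall_smul_eq W m (Place.Completion (Sum.inr q : Place K))
        (htrivT q hq)⟩
  · push Not at hvT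
    refine Or.inl ?_
    rw [map_zsmul]
    exact AddSubgroup.zsmul_mem _
      (mem_kummerLocalConditionAt_res_of_mem_selmerLocalKer W _ _ (hc v hv hvT)) k

include halt hPT' hι in
/-- **Non-vanishing form** of `ctLevelPairing_pullback_eq_localTerm_kolyvagin`: `B(ι z, ι t) ≠ 0`
iff the local term at `λ` of the data is non-zero. In the proof of McCallum's Thm. 5.4 the right
side is his Lemma 5.3 (perfectness of the Tate pairing on the `ν`-eigenlines at `λ`) with Prop. 4.4.
[cite: McCallumLMS1991, §5 Lemma 5.3, Thm. 5.4 (proof)] -/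
theorem ctLevelPairing_pullback_ne_zero_iff_localTerm_kolyvagin [W.IsElliptic]
    (z t : selmerGroup W ((m * m : ℕ) : ℤ))
    (c : galoisCohomology (W.torsionGaloisModule ((m * m : ℕ) : ℤ)) 1) (k : ℤ)
    (hz : (z : galH1Torsion W ((m * m : ℕ) : ℤ)) = (m : ℤ) • k • c)
    (v₀ : HeightOneSpectrum (𝓞 K)) (T : Set (HeightOneSpectrum (𝓞 K)))
    (hc : ∀ v : Place K, v ≠ Sum.inr v₀ → (∀ q ∈ T, v ≠ Sum.inr q) →
      c ∈ selmerLocalKer W (Place.Completion v) ((m * m : ℕ) : ℤ))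
    (htT : ∀ q ∈ T, galoisCohomology.res (W.torsionGaloisModule ((m * m : ℕ) : ℤ))
      (Place.Completion (Sum.inr q : Place K)) 1 (t : galH1Torsion W ((m * m : ℕ) : ℤ)) = 0)
    (htrivT : ∀ q ∈ T, ∀ (g : absoluteGaloisGroup (Place.Completion (Sum.inr q : Place K)))
      (Q : geomTorsion W ((m * m : ℕ) : ℤ)), absGaloisRestrict K (Place.Completion (Sum.inr q : Place K)) g • Q = Q)
    (D : FirstCaseData W m) (hD₁ : D.b₁ = k • c)
    (hDt : galoisCohomology.map (inclKD W m m) 1 D.b' = (t : galH1Torsion W ((m * m : ℕ) : ℤ))) :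
    ctLevelPairing W m e hμ hadd₁ hadd₂ hgal inv halt hPT' hH3 hfin (ι z) (ι t) ≠ 0 ↔
      D.localTerm e hμ hadd₁ hadd₂ hgal inv (Sum.inr v₀) ≠ 0 := by
  rw [ctLevelPairing_pullback_eq_localTerm_kolyvagin e hμ hadd₁ hadd₂ hgal inv halt hPT' hH3 hfin ι hι
    z t c k hz v₀ T hc htT htrivT D hD₁ hDt]
  exact not_congr ⟨fun h0 => zmodToCircle_injective _ (h0.trans (map_zero _).symm),
    fun h0 => by rw [h0, map_zero]⟩

end Kolyvagin

end Literature.NumberTheory.EllipticCurves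

end
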